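import Summits.NavierStokesRegularity.NavierStokesRegularity.Theorems.TypeICertificateLadderTargetAmplitudeRung
import Summits.NavierStokesRegularity.NavierStokesRegularity.Theorems.TypeICertificateLadderLadderGlue
import HarnessLib

/-!
# Crux `Target` = `TypeICertificateLadder.NoTypeIBlowup` (stmt-NavierStokesRegularity-1217), line
# `depletion-ladder`: THE OSCILLATION RUNG (`X_C` in Galilean currency, all `C < 2.4115`) and the crux
# residual in LOG-INTEGRAL currency

`--supports stmt-NavierStokesRegularity-1217` (consumer of `…AmplitudeRung.lean`; strengthens the rung
of record `StrainCube.hasSmoothExtensionPast_of_rate_lt_sharp` / `rung_of_le_sharp` and re-types the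
residual of `…StrainCubeCruxResidual.lean`).

* `exists_logAmplitude_of_eventually_oscillationRate` — bookkeeping: an EVENTUAL oscillation rate
  `√(T−t)·|u(t,x) − c_t| ≤ C√ν` (some `c_t`, all `x`, all `t` near `T`) along a classical Leray–Hopf
  rapidly-decaying-datum solution yields a gauge `c`, an amplitude `m ≥ |u − c|` on `(0,T)` and `B ≥ 0`
  with `∫₀ᵗ m² ≤ B + C²ν log(T/(T−t))` (Tao cover before the onset, `m² = C²ν/(T−s)` after).
* `hasSmoothExtensionPast_of_oscillationRate` — **THE OSCILLATION RUNG**: if eventually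
  `√(T−t)·sup_x |u(t,x) − c_t| ≤ C√ν` for SOME constants `c_t` (one per time) with
  `((2+√3)/9)·C < 1`, the solution extends past `T`; `…_le`: all `0 < C ≤ 2.41`. The landed sup-form
  rung is `c_t = 0`. For a profile whose large velocities near the singularity point in one direction
  (a jet), `inf_c sup|u − c|` is half of `sup|u|`: the reach in `sup|u|`-currency doubles there.
* `target_of_logDescent`, `logDescent_of_target`, `target_iff_logDescent` — after the log-integral rung
  the crux `Target` (VERBATIM) is equivalent to the **log-descent**: every Type-I(`C`) classical
  Leray–Hopf rapidly-decaying-datum solution that does NOT extend past `T` admits a gauge `c`, an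
  amplitude `m ≥ |u − c|` and `A < 81(7−4√3)`, `B` with `∫₀ᵗ m² ≤ B + Aν log(T/(T−t))` on `(0,T)`.
* `logDescent_of_descentToRungTwo` — the registered residual S3 `DescentToRungTwo` (eventual rate
  `≤ 2√ν`) implies the log-descent directly (`A = 4 < 5.81`): what a proof of the crux through this
  line must now supply is a LOG-TIME-AVERAGED, GAUGE-FREE amplitude bound, not a pointwise eventual one.

WHAT THIS IS NOT: not the crux; no statement here is stronger than `Target` (all are consequences of
it, `logDescent_of_target`). [folklore]
-/

noncomputable section

open Set Filter Topology MeasureTheory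
open scoped RealInnerProductSpace ENNReal NNReal Laplacian ContDiff
open Literature.Analysis.FluidPDE

namespace Summit.NavierStokesRegularity.NavierStokesRegularity.Theorems.DepletionLadder

-- the problem directory repeats the summit name (`NavierStokesRegularity/NavierStokesRegularity`)
set_option linter.dupNamespace false

open Summit.NavierStokesRegularity.NavierStokesRegularity.Theorems.RungReynoldsOne
open Summit.NavierStokesRegularity.NavierStokesRegularity.Theorems.DepletionLadder.StrainCube

/-- **From an eventual oscillation rate to a log-integral amplitude** (bookkeeping). If along a
classical Leray–Hopf rapidly-decaying-datum solution on `[0,T)` eventually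
`√(T−t)·|u(t,x) − c_t| ≤ C√ν` for some `c_t` and all `x`, then there are a gauge `c : ℝ → ℝ³`, an
amplitude `m` with `|u(t,x) − c(t)| ≤ m(t)` on `(0,T)` and `B ≥ 0` with
`∫₀ᵗ m(s)² ds ≤ B + C²ν log(T/(T−t))` for all `t ∈ (0,T)`: before the onset `t₀` take `c = 0` and the
Tao-cover bound `B₀` of `|u|` on `[0,t₀]`, after it `m(s)² = C²ν/(T−s)`; `B = B₀²T`. [folklore] -/
theorem exists_logAmplitude_of_eventually_oscillationRate {ν T C : ℝ} (hν : 0 < ν) (hT : 0 < T)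
    {u : ℝ → EuclideanSpace ℝ (Fin 3) → EuclideanSpace ℝ (Fin 3)}
    {p : ℝ → EuclideanSpace ℝ (Fin 3) → ℝ}
    (hsol : IsClassicalNSSolutionOn (Ico 0 T) ν 0 u p) (hLH : IsLerayHopfOn T ν 0 (u 0) u)
    (hdec : HasRapidSpatialDecay (u 0))
    (hrate : ∀ᶠ t in 𝓝[<] T, ∃ c : EuclideanSpace ℝ (Fin 3), ∀ x,
      Real.sqrt (T - t) * ‖u t x - c‖ ≤ C * Real.sqrt ν) :
    ∃ (c : ℝ → EuclideanSpace ℝ (Fin 3)) (m : ℝ → ℝ) (B : ℝ), 0 ≤ B ∧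
      (∀ t ∈ Ioo 0 T, ∀ x, ‖u t x - c t‖ ≤ m t) ∧
      ∀ t ∈ Ioo 0 T, ∫⁻ s in Ioo 0 t, ENNReal.ofReal (m s ^ 2) ≤
        ENNReal.ofReal (B + C ^ 2 * ν * Real.log (T / (T - t))) := by
  -- the onset `t₀ ∈ (0, T)` of the rate
  obtain ⟨a, haT, hsub⟩ := mem_nhdsLT_iff_exists_Ioo_subset.1 hrate
  set t₀ : ℝ := (max a (T / 2) + T) / 2 with ht₀def
  have hmax : max a (T / 2) < T := max_lt haT (by linarith)
  have hat₀ : a < t₀ := by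
    have := le_max_left a (T / 2); rw [ht₀def]; linarith
  have ht₀ : t₀ ∈ Ioo 0 T := by
    have := le_max_right a (T / 2); rw [ht₀def]; constructor <;> linarith
  have hrate' : ∀ s ∈ Ico t₀ T, ∃ c : EuclideanSpace ℝ (Fin 3), ∀ x,
      Real.sqrt (T - s) * ‖u s x - c‖ ≤ C * Real.sqrt ν :=
    fun s hs => hsub ⟨hat₀.trans_le hs.1, hs.2⟩
  -- a sup bound on `[0, t₀]` from the Tao cover at `T' = t₀`
  obtain ⟨q₀, hsol₀, hu₀, -, -⟩ := stub_taoCover hν hT hsol hLH hdec ht₀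
  obtain ⟨B₀, hB₀0, hB₀⟩ := exists_forall_norm_le_of_hasBoundedSobolevNormsOn hsol₀ hu₀
  -- the gauge and the amplitude
  classical
  set c : ℝ → EuclideanSpace ℝ (Fin 3) := fun s =>
    if h : s ∈ Ico t₀ T then Classical.choose (hrate' s h) else 0 with hcdef
  set m : ℝ → ℝ := fun s =>
    if s ∈ Ico t₀ T then Real.sqrt (C ^ 2 * ν / (T - s)) else B₀ with hmdef
  have hC2 : 0 ≤ C ^ 2 * ν := by positivity
  refine ⟨c, m, B₀ ^ 2 * T, by positivity, fun s hs x => ?_, fun t ht => ?_⟩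
  · by_cases h : s ∈ Ico t₀ T
    · have hspec := Classical.choose_spec (hrate' s h) x
      have hc : c s = Classical.choose (hrate' s h) := by rw [hcdef]; simp only [dif_pos h]
      have hm : m s = Real.sqrt (C ^ 2 * ν / (T - s)) := by rw [hmdef]; simp only [if_pos h]
      rw [hc, hm]
      exact Real.le_sqrt_of_sq_le (sq_norm_le_of_rate_mul hν.le hs.2 hspec)
    · have hst : s < t₀ := by
        by_contra hle
        exact h ⟨not_lt.mp hle, hs.2⟩
      have hc : c s = 0 := by rw [hcdef]; simp only [dif_neg h]
      have hm : m s = B₀ := by rw [hmdef]; simp only [if_neg h]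
      rw [hc, hm, sub_zero]
      exact hB₀ s ⟨hs.1.le, hst.le⟩ x
  · have hTt : 0 < T - t := sub_pos.2 ht.2
    have hlog : 0 ≤ Real.log (T / (T - t)) :=
      Real.log_nonneg ((one_le_div hTt).2 (by linarith [ht.1]))
    -- pointwise: `m(s)² ≤ B₀² + C²ν/(T−s)` on `(0, T)`
    have hmsq : ∀ s ∈ Ioo 0 T, m s ^ 2 ≤ B₀ ^ 2 + C ^ 2 * ν / (T - s) := by
      intro s hs
      have hTs : 0 < T - s := sub_pos.2 hs.2
      have h2 : 0 ≤ C ^ 2 * ν / (T - s) := by positivity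
      by_cases h : s ∈ Ico t₀ T
      · have hm : m s = Real.sqrt (C ^ 2 * ν / (T - s)) := by rw [hmdef]; simp only [if_pos h]
        rw [hm, Real.sq_sqrt h2]
        nlinarith [sq_nonneg B₀]
      · have hm : m s = B₀ := by rw [hmdef]; simp only [if_neg h]
        rw [hm]
        linarith
    calc ∫⁻ s in Ioo 0 t, ENNReal.ofReal (m s ^ 2)
        ≤ ∫⁻ s in Ioo 0 t, (ENNReal.ofReal (B₀ ^ 2) + ENNReal.ofReal (C ^ 2 * ν / (T - s))) := by
          refine setLIntegral_mono' measurableSet_Ioo fun s hs => ?_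
          rw [← ENNReal.ofReal_add (sq_nonneg _) (div_nonneg hC2 (by linarith [hs.2, ht.2]))]
          exact ENNReal.ofReal_le_ofReal (hmsq s ⟨hs.1, hs.2.trans ht.2⟩)
      _ = ENNReal.ofReal (B₀ ^ 2) * volume (Ioo 0 t) +
            ∫⁻ s in Ioo 0 t, ENNReal.ofReal (C ^ 2 * ν / (T - s)) := by
          rw [lintegral_add_left measurable_const, setLIntegral_const]
      _ = ENNReal.ofReal (B₀ ^ 2 * t) + ENNReal.ofReal (C ^ 2 * ν * Real.log (T / (T - t))) := by
          rw [lintegral_Ioo_div_sub_eq hC2 ht.1.le ht.2, Real.volume_Ioo, sub_zero,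
            ← ENNReal.ofReal_mul (sq_nonneg _)]
      _ = ENNReal.ofReal (B₀ ^ 2 * t + C ^ 2 * ν * Real.log (T / (T - t))) :=
          (ENNReal.ofReal_add (mul_nonneg (sq_nonneg _) ht.1.le) (mul_nonneg hC2 hlog)).symm
      _ ≤ ENNReal.ofReal (B₀ ^ 2 * T + C ^ 2 * ν * Real.log (T / (T - t))) := by
          refine ENNReal.ofReal_le_ofReal ?_
          nlinarith [sq_nonneg B₀, ht.2]

/-- **THE OSCILLATION RUNG.** Let `u` be a classical solution of the unforced Navier–Stokes system on
`ℝ³ × [0,T)` (`ν, T > 0`), Leray–Hopf from its rapidly decaying datum. If for all `t` near `T` there is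
a constant vector `c_t` with `√(T−t)·|u(t,x) − c_t| ≤ C√ν` for all `x`, where `0 < C` and
`((2+√3)/9)·C < 1` (`C < 18 − 9√3 = 2.4115…`), then `u` extends to a classical solution past `T`.
The landed `StrainCube.hasSmoothExtensionPast_of_rate_lt_sharp` is the case `c_t = 0`. [folklore] -/
theorem hasSmoothExtensionPast_of_oscillationRate {ν T C : ℝ} (hν : 0 < ν) (hT : 0 < T) (hC : 0 < C)
    (hκC : (2 + Real.sqrt 3) / 9 * C < 1)
    {u : ℝ → EuclideanSpace ℝ (Fin 3) → EuclideanSpace ℝ (Fin 3)}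
    {p : ℝ → EuclideanSpace ℝ (Fin 3) → ℝ}
    (hsol : IsClassicalNSSolutionOn (Ico 0 T) ν 0 u p) (hLH : IsLerayHopfOn T ν 0 (u 0) u)
    (hdec : HasRapidSpatialDecay (u 0))
    (hrate : ∀ᶠ t in 𝓝[<] T, ∃ c : EuclideanSpace ℝ (Fin 3), ∀ x,
      Real.sqrt (T - t) * ‖u t x - c‖ ≤ C * Real.sqrt ν) :
    HasSmoothExtensionPast ν 0 u T := by
  obtain ⟨c, m, B, hB, hm, hint⟩ :=
    exists_logAmplitude_of_eventually_oscillationRate hν hT hsol hLH hdec hrate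
  have hA1 : ((2 + Real.sqrt 3) / 9) ^ 2 * C ^ 2 < 1 := by
    have h0 : 0 < (2 + Real.sqrt 3) / 9 * C := by positivity
    have h1 : ((2 + Real.sqrt 3) / 9 * C) ^ 2 < 1 := by nlinarith
    rw [mul_pow] at h1
    exact h1
  exact hasSmoothExtensionPast_of_logIntegral_oscillation hν hT (sq_nonneg C) hB hA1 hsol hLH hdec
    hm hint

/-- **All oscillation rungs up to `2.41`**: for `0 < C ≤ 2.41` an eventual oscillation rate
`√(T−t)·inf_c sup_x |u(t,x) − c| ≤ C√ν` (attained form: some `c_t` at each time) forces a classical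
extension past `T` (`(2+√3)/9 · 2.41 < 1`). [folklore] -/
theorem hasSmoothExtensionPast_of_oscillationRate_le {ν T C : ℝ} (hν : 0 < ν) (hT : 0 < T)
    (hC : 0 < C) (hC' : C ≤ 2.41)
    {u : ℝ → EuclideanSpace ℝ (Fin 3) → EuclideanSpace ℝ (Fin 3)}
    {p : ℝ → EuclideanSpace ℝ (Fin 3) → ℝ}
    (hsol : IsClassicalNSSolutionOn (Ico 0 T) ν 0 u p) (hLH : IsLerayHopfOn T ν 0 (u 0) u)
    (hdec : HasRapidSpatialDecay (u 0))
    (hrate : ∀ᶠ t in 𝓝[<] T, ∃ c : EuclideanSpace ℝ (Fin 3), ∀ x,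
      Real.sqrt (T - t) * ‖u t x - c‖ ≤ C * Real.sqrt ν) :
    HasSmoothExtensionPast ν 0 u T := by
  have h3 : Real.sqrt 3 < 1.7321 := by
    rw [Real.sqrt_lt' (by norm_num)]; norm_num
  have hκC : (2 + Real.sqrt 3) / 9 * C < 1 := by
    have h0 : 0 ≤ Real.sqrt 3 := Real.sqrt_nonneg _
    nlinarith
  exact hasSmoothExtensionPast_of_oscillationRate hν hT hC hκC hsol hLH hdec hrate

/-! ## The crux residual in log-integral currency -/

/-- **Log-descent ⇒ crux.** If every Type-I(`C`) (`C > 0`) classical Leray–Hopf rapidly-decaying-datum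
solution that does not extend past `T` admits a gauge `c`, an amplitude `m ≥ |u − c|` on `(0,T)` and
`A, B ≥ 0` with `((2+√3)/9)²A < 1` and `∫₀ᵗ m² ≤ B + Aν log(T/(T−t))` on `(0,T)`, then there is no
Type-I blow-up at all (`ThreadingFlux.Target`, verbatim): ladder glue + the log-integral rung.
[folklore] -/
theorem target_of_logDescent
    (hD : ∀ C : ℝ, 0 < C → ∀ (ν T : ℝ), 0 < ν → 0 < T →
      ∀ (u : ℝ → EuclideanSpace ℝ (Fin 3) → EuclideanSpace ℝ (Fin 3))
        (p : ℝ → EuclideanSpace ℝ (Fin 3) → ℝ),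
        IsClassicalNSSolutionOn (Set.Ico 0 T) ν 0 u p → IsLerayHopfOn T ν 0 (u 0) u →
        HasRapidSpatialDecay (u 0) →
        (∀ᶠ t in 𝓝[<] T, ∀ x, Real.sqrt (T - t) * ‖u t x‖ ≤ C * Real.sqrt ν) →
        ¬ HasSmoothExtensionPast ν 0 u T →
        ∃ (c : ℝ → EuclideanSpace ℝ (Fin 3)) (m : ℝ → ℝ) (A B : ℝ), 0 ≤ A ∧ 0 ≤ B ∧
          ((2 + Real.sqrt 3) / 9) ^ 2 * A < 1 ∧
          (∀ t ∈ Ioo 0 T, ∀ x, ‖u t x - c t‖ ≤ m t) ∧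
          ∀ t ∈ Ioo 0 T, ∫⁻ s in Ioo 0 t, ENNReal.ofReal (m s ^ 2) ≤
            ENNReal.ofReal (B + A * ν * Real.log (T / (T - t)))) :
    ∀ (ν T : ℝ), 0 < ν → 0 < T →
      ∀ (u : ℝ → EuclideanSpace ℝ (Fin 3) → EuclideanSpace ℝ (Fin 3))
        (p : ℝ → EuclideanSpace ℝ (Fin 3) → ℝ),
        IsClassicalNSSolutionOn (Set.Ico 0 T) ν 0 u p → IsLerayHopfOn T ν 0 (u 0) u →
        HasRapidSpatialDecay (u 0) → IsTypeIBlowup u T → HasSmoothExtensionPast ν 0 u T := by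
  refine typeICertificateLadder_ladderGlue_proof fun C hC ν T hν hT u p hcl hLH hdec hrate => ?_
  by_contra hext
  obtain ⟨c, m, A, B, hA, hB, hA1, hm, hint⟩ := hD C hC ν T hν hT u p hcl hLH hdec hrate hext
  exact hext (hasSmoothExtensionPast_of_logIntegral_oscillation hν hT hA hB hA1 hcl hLH hdec hm hint)

/-- **Crux ⇒ log-descent** (vacuously: under the crux no Type-I(`C`) solution fails to extend).
[folklore] -/
theorem logDescent_of_target
    (hT : ∀ (ν T : ℝ), 0 < ν → 0 < T →
      ∀ (u : ℝ → EuclideanSpace ℝ (Fin 3) → EuclideanSpace ℝ (Fin 3))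
        (p : ℝ → EuclideanSpace ℝ (Fin 3) → ℝ),
        IsClassicalNSSolutionOn (Set.Ico 0 T) ν 0 u p → IsLerayHopfOn T ν 0 (u 0) u →
        HasRapidSpatialDecay (u 0) → IsTypeIBlowup u T → HasSmoothExtensionPast ν 0 u T) :
    ∀ C : ℝ, 0 < C → ∀ (ν T : ℝ), 0 < ν → 0 < T →
      ∀ (u : ℝ → EuclideanSpace ℝ (Fin 3) → EuclideanSpace ℝ (Fin 3))
        (p : ℝ → EuclideanSpace ℝ (Fin 3) → ℝ),
        IsClassicalNSSolutionOn (Set.Ico 0 T) ν 0 u p → IsLerayHopfOn T ν 0 (u 0) u →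
        HasRapidSpatialDecay (u 0) →
        (∀ᶠ t in 𝓝[<] T, ∀ x, Real.sqrt (T - t) * ‖u t x‖ ≤ C * Real.sqrt ν) →
        ¬ HasSmoothExtensionPast ν 0 u T →
        ∃ (c : ℝ → EuclideanSpace ℝ (Fin 3)) (m : ℝ → ℝ) (A B : ℝ), 0 ≤ A ∧ 0 ≤ B ∧
          ((2 + Real.sqrt 3) / 9) ^ 2 * A < 1 ∧
          (∀ t ∈ Ioo 0 T, ∀ x, ‖u t x - c t‖ ≤ m t) ∧
          ∀ t ∈ Ioo 0 T, ∫⁻ s in Ioo 0 t, ENNReal.ofReal (m s ^ 2) ≤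
            ENNReal.ofReal (B + A * ν * Real.log (T / (T - t))) := by
  intro C _ ν T hν hT' u p hcl hLH hdec hrate hext
  refine absurd (hT ν T hν hT' u p hcl hLH hdec ⟨C * Real.sqrt ν, ?_⟩) hext
  have hlt : ∀ᶠ t in 𝓝[<] T, t < T := self_mem_nhdsWithin
  filter_upwards [hrate, hlt] with t ht htT
  intro x
  have hTt : 0 < Real.sqrt (T - t) := Real.sqrt_pos.2 (sub_pos.2 htT)
  rw [le_div_iff₀ hTt, mul_comm]
  exact ht x

/-- **Crux ↔ log-descent**: after the log-integral rung, the crux `Target` of line `depletion-ladder` is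
exactly the log-descent (a gauge-free, log-time-averaged amplitude bound below `81(7−4√3)` for
non-extendable Type-I solutions). [folklore] -/
theorem target_iff_logDescent :
    (∀ (ν T : ℝ), 0 < ν → 0 < T →
      ∀ (u : ℝ → EuclideanSpace ℝ (Fin 3) → EuclideanSpace ℝ (Fin 3))
        (p : ℝ → EuclideanSpace ℝ (Fin 3) → ℝ),
        IsClassicalNSSolutionOn (Set.Ico 0 T) ν 0 u p → IsLerayHopfOn T ν 0 (u 0) u →
        HasRapidSpatialDecay (u 0) → IsTypeIBlowup u T → HasSmoothExtensionPast ν 0 u T) ↔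
    (∀ C : ℝ, 0 < C → ∀ (ν T : ℝ), 0 < ν → 0 < T →
      ∀ (u : ℝ → EuclideanSpace ℝ (Fin 3) → EuclideanSpace ℝ (Fin 3))
        (p : ℝ → EuclideanSpace ℝ (Fin 3) → ℝ),
        IsClassicalNSSolutionOn (Set.Ico 0 T) ν 0 u p → IsLerayHopfOn T ν 0 (u 0) u →
        HasRapidSpatialDecay (u 0) →
        (∀ᶠ t in 𝓝[<] T, ∀ x, Real.sqrt (T - t) * ‖u t x‖ ≤ C * Real.sqrt ν) →
        ¬ HasSmoothExtensionPast ν 0 u T →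
        ∃ (c : ℝ → EuclideanSpace ℝ (Fin 3)) (m : ℝ → ℝ) (A B : ℝ), 0 ≤ A ∧ 0 ≤ B ∧
          ((2 + Real.sqrt 3) / 9) ^ 2 * A < 1 ∧
          (∀ t ∈ Ioo 0 T, ∀ x, ‖u t x - c t‖ ≤ m t) ∧
          ∀ t ∈ Ioo 0 T, ∫⁻ s in Ioo 0 t, ENNReal.ofReal (m s ^ 2) ≤
            ENNReal.ofReal (B + A * ν * Real.log (T / (T - t)))) :=
  ⟨logDescent_of_target, target_of_logDescent⟩

/-- **S3 ⇒ log-descent, directly.** The registered residual `stub_descentToRungTwo` of the skeleton of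
record (VERBATIM after unfolding `DescentToRungTwo`: every Type-I(`C`), `C ≥ 2`, non-extendable
classical Leray–Hopf rapidly-decaying-datum solution eventually has rate `≤ 2√ν`) implies the
log-descent with the gauge `c = 0` and `A = 4` (`((2+√3)/9)²·4 < 1`): raise `C` to `max C 2`, descend,
and convert the eventual rate into a log-integral amplitude
(`exists_logAmplitude_of_eventually_oscillationRate`). [folklore] -/
theorem logDescent_of_descentToRungTwo
    (hD2 : ∀ C : ℝ, 2 ≤ C → ∀ (ν T : ℝ), 0 < ν → 0 < T →
      ∀ (u : ℝ → EuclideanSpace ℝ (Fin 3) → EuclideanSpace ℝ (Fin 3))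
        (p : ℝ → EuclideanSpace ℝ (Fin 3) → ℝ),
        IsClassicalNSSolutionOn (Set.Ico 0 T) ν 0 u p → IsLerayHopfOn T ν 0 (u 0) u →
        HasRapidSpatialDecay (u 0) →
        (∀ᶠ t in 𝓝[<] T, ∀ x, Real.sqrt (T - t) * ‖u t x‖ ≤ C * Real.sqrt ν) →
        ¬ HasSmoothExtensionPast ν 0 u T →
        ∀ᶠ t in 𝓝[<] T, ∀ x, Real.sqrt (T - t) * ‖u t x‖ ≤ 2 * Real.sqrt ν) :
    ∀ C : ℝ, 0 < C → ∀ (ν T : ℝ), 0 < ν → 0 < T →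
      ∀ (u : ℝ → EuclideanSpace ℝ (Fin 3) → EuclideanSpace ℝ (Fin 3))
        (p : ℝ → EuclideanSpace ℝ (Fin 3) → ℝ),
        IsClassicalNSSolutionOn (Set.Ico 0 T) ν 0 u p → IsLerayHopfOn T ν 0 (u 0) u →
        HasRapidSpatialDecay (u 0) →
        (∀ᶠ t in 𝓝[<] T, ∀ x, Real.sqrt (T - t) * ‖u t x‖ ≤ C * Real.sqrt ν) →
        ¬ HasSmoothExtensionPast ν 0 u T →
        ∃ (c : ℝ → EuclideanSpace ℝ (Fin 3)) (m : ℝ → ℝ) (A B : ℝ), 0 ≤ A ∧ 0 ≤ B ∧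
          ((2 + Real.sqrt 3) / 9) ^ 2 * A < 1 ∧
          (∀ t ∈ Ioo 0 T, ∀ x, ‖u t x - c t‖ ≤ m t) ∧
          ∀ t ∈ Ioo 0 T, ∫⁻ s in Ioo 0 t, ENNReal.ofReal (m s ^ 2) ≤
            ENNReal.ofReal (B + A * ν * Real.log (T / (T - t))) := by
  intro C _ ν T hν hT u p hcl hLH hdec hrate hext
  have hrate' : ∀ᶠ t in 𝓝[<] T, ∀ x, Real.sqrt (T - t) * ‖u t x‖ ≤ max C 2 * Real.sqrt ν := by
    filter_upwards [hrate] with t ht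
    intro x
    exact (ht x).trans (mul_le_mul_of_nonneg_right (le_max_left _ _) (Real.sqrt_nonneg ν))
  have h2 := hD2 (max C 2) (le_max_right _ _) ν T hν hT u p hcl hLH hdec hrate' hext
  have h2' : ∀ᶠ t in 𝓝[<] T, ∃ c : EuclideanSpace ℝ (Fin 3), ∀ x,
      Real.sqrt (T - t) * ‖u t x - c‖ ≤ 2 * Real.sqrt ν := by
    filter_upwards [h2] with t ht
    exact ⟨0, fun x => by simpa using ht x⟩
  obtain ⟨c, m, B, hB, hm, hint⟩ :=
    exists_logAmplitude_of_eventually_oscillationRate hν hT hcl hLH hdec h2'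
  refine ⟨c, m, 2 ^ 2, B, by norm_num, hB, ?_, hm, hint⟩
  have h3 : Real.sqrt 3 < 1.7321 := by
    rw [Real.sqrt_lt' (by norm_num)]; norm_num
  have h0 : 0 ≤ Real.sqrt 3 := Real.sqrt_nonneg _
  nlinarith

end Summit.NavierStokesRegularity.NavierStokesRegularity.Theorems.DepletionLadder

end
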